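import Literature.Computability.AlgebraicComplexity.BorderRankMatMul223CertData1
import Literature.Computability.AlgebraicComplexity.BorderRankMatMul223CertData2
import Literature.Computability.AlgebraicComplexity.BorderRankMatMul223CertData3
import Literature.Computability.AlgebraicComplexity.BorderRankMatMul223CertData4
import Literature.Computability.AlgebraicComplexity.BorderRankMatMul223CertData5
import HarnessLib

/-!
# The `⟨2,2,3⟩` border apolarity test, torus-fixed candidates (III): coverage and soundness

Topic `Literature/Computability/AlgebraicComplexity`.  Assembles the certificate of
`BorderRankMatMul223Cert.lean` / `…CertData1…5.lean` and proves its meaning: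

* `certList`, `check_certList` — all `816` entries are valid (from the data files' kernel runs);
* `covers_eq_true` — every triple `p < q < s < 18` has an entry (kernel run);
* `MatMul223.rank_test_ge` — **SOUNDNESS**: for every field `K` of characteristic `0` and every set `S`
  of at least `15` of the `18` weight lines of `M_⟨223⟩(C*)^⊥`, the `(210)` products
  `{ω_k · e_a : k ∈ S, a ∈ A*}` span a space of dimension `≥ 52` (`> dim S²A* ⊗ B* − 9 = 51`) or the
  `(120)` products span a space of dimension `≥ 76` (`> dim A* ⊗ S²B* − 9 = 75`): every torus-fixed
  candidate `F₁₁₀` of codimension `9` fails the `(210)` or the `(120)` test of CHL 2023, §3 (their §7.2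
  checks the eight Borel-fixed ones).

## References

* A. Conner, A. Harper, J. M. Landsberg, *New lower bounds for matrix multiplication and `det₃`*,
  Forum Math. Pi 11 (2023) e17 = arXiv:1911.07981, Thm. 1.3, §3 (tests), §4 (`M(C*)^⊥`), §7.2
  (`M_⟨223⟩`: "eight 𝔹-fixed 3-planes … (210)-test … (120)-test"). [ConnerHarperLandsberg2023]
-/

namespace Literature.Computability.AlgebraicComplexity

namespace MatMul223

/-! ## The full certificate list and its validity -/

/-- All `816` certificates.
[cite: ConnerHarperLandsberg2023, §7.2 (the (210)- and (120)-tests for M_⟨223⟩)] -/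
def certList : List CertEntry :=
  certData1 ++ certData2 ++ certData3 ++ certData4 ++ certData5

/-- Every certificate is valid (the data files' kernel runs, concatenated).
[cite: ConnerHarperLandsberg2023, §7.2 (the (210)- and (120)-tests for M_⟨223⟩)] -/
theorem check_certList : checkChunk certList = true :=
  checkChunk_append (checkChunk_append (checkChunk_append (checkChunk_append check_certData1 check_certData2) check_certData3) check_certData4) check_certData5

/-- Coverage: every triple `p < q < s < 18` of omitted weight lines has an entry.
[cite: ConnerHarperLandsberg2023, §7.2 (the (210)- and (120)-tests for M_⟨223⟩)] -/
def covers : Bool :=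
  (List.range 18).all fun p => (List.range 18).all fun q => (List.range 18).all fun s =>
    decide (p < q → q < s → certList.any fun e => e.p == p && e.q == q && e.s == s)

/-- **The kernel run for coverage.**
[cite: ConnerHarperLandsberg2023, §7.2 (the (210)- and (120)-tests for M_⟨223⟩)] -/
theorem covers_eq_true : covers = true := by
  decide +kernel

/-! ## Soundness of the checker -/

/-- Coverage and validity of the certificate list.
[cite: ConnerHarperLandsberg2023, §7.2 (the (210)- and (120)-tests for M_⟨223⟩)] -/
theorem exists_certEntry {p q s : ℕ} (hpq : p < q) (hqs : q < s) (hs : s < 18) :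
    ∃ e ∈ certList, e.p = p ∧ e.q = q ∧ e.s = s ∧ e.ok = true := by
  have hc := covers_eq_true
  unfold covers at hc
  rw [List.all_eq_true] at hc
  have hp := hc p (List.mem_range.2 (by omega))
  rw [List.all_eq_true] at hp
  have hq := hp q (List.mem_range.2 (by omega))
  rw [List.all_eq_true] at hq
  have hs' := hq s (List.mem_range.2 hs)
  rw [decide_eq_true_eq] at hs'
  obtain ⟨e, he, hpqs⟩ := List.any_eq_true.1 (hs' hpq hqs)
  simp only [Bool.and_eq_true, beq_iff_eq] at hpqs
  have hv := check_certList
  unfold checkChunk at hv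
  rw [List.all_eq_true] at hv
  exact ⟨e, he, hpqs.1.1, hpqs.1.2, hpqs.2, hv e he⟩

/-- What a valid entry guarantees: the row count and, for each row `i < n`, an allowed weight line,
a nonzero diagonal value and zeros left of the diagonal.
[cite: ConnerHarperLandsberg2023, §7.2 (the (210)- and (120)-tests for M_⟨223⟩)] -/
theorem CertEntry.ok_spec {e : CertEntry} (h : e.ok = true) :
    e.rows.length = e.n ∧ ∀ i < e.n,
      ((e.row i).1 < 18 ∧ (e.row i).1 ≠ e.p ∧ (e.row i).1 ≠ e.q ∧ (e.row i).1 ≠ e.s) ∧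
        e.val i i ≠ 0 ∧ ∀ j < i, e.val i j = 0 := by
  unfold CertEntry.ok at h
  simp only [Bool.and_eq_true, List.all_eq_true, List.mem_range, decide_eq_true_eq,
    beq_iff_eq] at h
  obtain ⟨⟨-, hlen⟩, h⟩ := h
  refine ⟨hlen, fun i hi => ?_⟩
  obtain ⟨⟨h1, h2⟩, h3⟩ := h i hi
  exact ⟨h1, h2, fun j hj => h3 j (by omega) hj⟩

section Soundness

variable (K : Type*) [Field K] [CharZero K]

omit [CharZero K] in
/-- Rows with an upper triangular matrix of pivot values (nonzero diagonal) span dimension `≥ n`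
inside any set containing them. [folklore] -/
private theorem le_finrank_span_of_triangular {ι : Type*} [Fintype ι] {n : ℕ} (r : Fin n → (ι → K))
    (π : Fin n → ι)
    (hdiag : ∀ i, r i (π i) ≠ 0) (hupper : ∀ i j : Fin n, j < i → r i (π j) = 0)
    {T : Set (ι → K)} (hsub : ∀ i, r i ∈ T) : n ≤ Module.finrank K (Submodule.span K T) := by
  classical
  let N : Matrix (Fin n) (Fin n) K := fun i j => r i (π j)
  have hdet : N.det ≠ 0 := by
    rw [Matrix.det_of_upperTriangular]
    · exact Finset.prod_ne_zero_iff.2 fun i _ => hdiag i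
    · intro i j hij
      exact hupper i j hij
  have hli : LinearIndependent K r := by
    have hrows : LinearIndependent K (fun i => N i) :=
      Matrix.linearIndependent_rows_of_det_ne_zero hdet
    have hcomp : (fun i => N i) = (LinearMap.funLeft K K π) ∘ r := by
      funext i j; rfl
    rw [hcomp] at hrows
    exact LinearIndependent.of_comp _ hrows
  have hsub' : Set.range r ⊆ T := by
    rintro _ ⟨i, rfl⟩; exact hsub i
  calc n = Fintype.card (Fin n) := (Fintype.card_fin n).symm
    _ = Module.finrank K (Submodule.span K (Set.range r)) := (finrank_span_eq_card hli).symm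
    _ ≤ _ := Submodule.finrank_mono (Submodule.span_mono hsub')

/-- **Soundness: every torus-fixed candidate fails a test.** For every field `K` of characteristic
`0` and every set `S` of at least `15` of the `18` weight lines of `M_⟨223⟩(C*)^⊥`, the `(210)`
products `{ω_k · e_a : k ∈ S, a}` span dimension `≥ 52` or the `(120)` products `{ω_k · e_b : k ∈ S, b}`
span dimension `≥ 76`. This is the `⟨2,2,3⟩`, `r = 9` case of the border apolarity tests of CHL 2023,
§3, for all torus-fixed `F₁₁₀` (their §7.2 treats the Borel-fixed ones).
[cite: ConnerHarperLandsberg2023, §3 and §7.2] -/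
theorem rank_test_ge (S : Finset (Fin 18)) (hS : 15 ≤ S.card) :
    52 ≤ Module.finrank K (Submodule.span K (genSetA K S)) ∨
      76 ≤ Module.finrank K (Submodule.span K (genSetB K S)) := by
  classical
  -- three weight lines `p < q < s` outside of which everything lies in `S`
  obtain ⟨p, q, s, hpq, hqs, hs, hcov⟩ : ∃ p q s : ℕ, p < q ∧ q < s ∧ s < 18 ∧
      ∀ k : Fin 18, k.val ≠ p → k.val ≠ q → k.val ≠ s → k ∈ S := by
    have hc : Sᶜ.card ≤ 3 := by
      rw [Finset.card_compl, Fintype.card_fin]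
      omega
    obtain ⟨T, hT, -, hTc⟩ :=
      Finset.exists_subsuperset_card_eq (Finset.subset_univ Sᶜ) hc (by simp)
    obtain ⟨x, y, z, hxy, hxz, hyz, rfl⟩ := Finset.card_eq_three.1 hTc
    have key : ∀ k : Fin 18, k ≠ x → k ≠ y → k ≠ z → k ∈ S := by
      intro k hx hy hz
      by_contra hk
      have hm : k ∈ ({x, y, z} : Finset (Fin 18)) := hT (Finset.mem_compl.2 hk)
      simp only [Finset.mem_insert, Finset.mem_singleton] at hm
      rcases hm with h | h | h
      · exact hx h
      · exact hy h
      · exact hz h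
    have hxy' : x.val ≠ y.val := fun e => hxy (Fin.ext e)
    have hxz' : x.val ≠ z.val := fun e => hxz (Fin.ext e)
    have hyz' : y.val ≠ z.val := fun e => hyz (Fin.ext e)
    have hx18 := x.isLt
    have hy18 := y.isLt
    have hz18 := z.isLt
    refine ⟨min x.val (min y.val z.val),
      x.val + y.val + z.val - min x.val (min y.val z.val) - max x.val (max y.val z.val),
      max x.val (max y.val z.val), ?_, ?_, ?_, fun k hp hq hs' => key k ?_ ?_ ?_⟩
    · omega
    · omega
    · omega
    · intro e; subst e; omega
    · intro e; subst e; omega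
    · intro e; subst e; omega
  obtain ⟨e, -, hep, heq, hes, hok⟩ := exists_certEntry hpq hqs hs
  obtain ⟨-, hspec⟩ := CertEntry.ok_spec hok
  -- membership of the rows' weight lines in `S`
  have hmemS : ∀ i < e.n, decK (e.row i).1 ∈ S := by
    intro i hi
    have h1 := (hspec i hi).1
    have hval : (decK (e.row i).1).val = (e.row i).1 := Nat.mod_eq_of_lt h1.1
    apply hcov
    · rw [hval, ← hep]; exact h1.2.1
    · rw [hval, ← heq]; exact h1.2.2.1
    · rw [hval, ← hes]; exact h1.2.2.2
  cases ht : e.test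
  · -- the `(210)` test, `52` rows
    have hn : e.n = 52 := by simp [CertEntry.n, ht]
    left
    refine le_finrank_span_of_triangular K
      (fun i : Fin 52 => rowFunA K (decK (e.row i).1) (decA (e.row i).2.1))
      (fun j : Fin 52 => decTA (e.row j).2.2) ?_ ?_ ?_
    · intro i
      have h := (hspec i (by rw [hn]; exact i.isLt)).2.1
      simp only [CertEntry.val, ht] at h
      rw [rowFunA_eq_cast, Int.cast_ne_zero]
      exact h
    · intro i j hij
      have h := (hspec i (by rw [hn]; exact i.isLt)).2.2 j hij
      simp only [CertEntry.val, ht] at h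
      rw [rowFunA_eq_cast, Int.cast_eq_zero]
      exact h
    · intro i
      exact ⟨decK (e.row i).1, hmemS i (by rw [hn]; exact i.isLt), decA (e.row i).2.1, rfl⟩
  · -- the `(120)` test, `76` rows
    have hn : e.n = 76 := by simp [CertEntry.n, ht]
    right
    refine le_finrank_span_of_triangular K
      (fun i : Fin 76 => rowFunB K (decK (e.row i).1) (decB (e.row i).2.1))
      (fun j : Fin 76 => decTB (e.row j).2.2) ?_ ?_ ?_
    · intro i
      have h := (hspec i (by rw [hn]; exact i.isLt)).2.1
      simp only [CertEntry.val, ht] at h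
      rw [rowFunB_eq_cast, Int.cast_ne_zero]
      exact h
    · intro i j hij
      have h := (hspec i (by rw [hn]; exact i.isLt)).2.2 j hij
      simp only [CertEntry.val, ht] at h
      rw [rowFunB_eq_cast, Int.cast_eq_zero]
      exact h
    · intro i
      exact ⟨decK (e.row i).1, hmemS i (by rw [hn]; exact i.isLt), decB (e.row i).2.1, rfl⟩

end Soundness

end MatMul223

end Literature.Computability.AlgebraicComplexity
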